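import Summits.QuantumFields.QCD.Theorems.QuarksAsStableActionStableActionBridgeDefs
import Literature.MathematicalPhysics.QuantumFieldTheory.QCDSiteReflectionPositivityProofs
import Literature.MathematicalPhysics.QuantumFieldTheory.QCDTimeReflectionProofs
import Literature.MathematicalPhysics.QuantumLattice.GrassmannIntegralPartial
import HarnessLib

/-!
# Abstract site-reflection positivity of the thermal functional of Wilson lattice QCD

Stub `stub_abstractThermalRP` of the line `Sketch` (reshape r3e, thermal re-basing) for the crux
`QuarksAsStableAction.StableActionBridge` (stmt-QuantumFields-9737).

The tree proves site-reflection positivity of Wilson lattice QCD with time-antiperiodic quarks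
(`WilsonQCDSiteReflectionPositivityAP_holds`, file `QCDSiteReflectionPositivityProofs`) for a local gauge-invariant
observable `A` placed at the origin of the odd torus `L = 2S + 1`, using of the torus function `U ↦ A.onTorus L 0 U` only:
(i) it depends on the positive links `posLinks S` only, (ii) its values are spectators of `negGens ∪ zeroGens` (generated
by the positive-time quark generators), (iii) it is coefficient-regular.  This file re-runs that pipeline (§RotObs → §Split
→ §Main → §Coef → §Support → §Covariance → §Regularity → §Dependence → §Positivity → §Final, and
`WilsonQCDSiteReflectionPositivityAP_im` of `QCDTimeReflectionProofs`) for an ARBITRARY torus function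
`X : GaugeConfig 4 (2S+1) SU(3) → FermiAlg Nf (2S+1)` with these three properties, `rotObs A U = R'(A.onTorus L 0 U)` being
replaced by `R'(X U) = spinUnrot (X U)`; the only new input is `spinUnrot_mem_spectator` (`R'` acts at fixed
flavour/site/colour, hence preserves the positive-time subalgebra).  Conclusion: `0 ≤ re ⟨X · Θ_T X⟩_AP`,
`im ⟨X · Θ_T X⟩_AP = 0` with `(Θ_T X)(U) = torusTheta (X (Θ'U))`.  The tree's `gObsT A mq t W` / `gCoef A mq t J W`
are re-expressed by two FILE-LOCAL notations `𝓖⟦𝐁, mq, t, W⟧` / `𝓰⟦𝐁, mq, t, J, W⟧` (term abbreviations; no definition is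
introduced, nothing global is shadowed).  Everything is proved; no named fact.  References: Montvay–Münster 1994 §4.2.3
(4.90)–(4.110); Osterwalder–Seiler 1978 §§2–3; Lüscher 1977 §3.
-/

noncomputable section

open scoped BigOperators ComplexConjugate ComplexOrder Matrix
open MeasureTheory Literature.MathematicalPhysics.QuantumFieldTheory Literature.MathematicalPhysics.QuantumLattice
open Literature.MathematicalPhysics.QuantumLattice.GrassmannAlgebra Literature.MathematicalPhysics.QuantumFieldTheory.WilsonNegRP
open Literature.MathematicalPhysics.QuantumFieldTheory.WilsonSiteRP
open Literature.MathematicalPhysics.QuantumFieldTheory.SliceIdx (emb)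

namespace Summit.QuantumFields.QCD.Cruxes.StableActionBridge.Sketch

local notation "𝔾" => Matrix.specialUnitaryGroup (Fin 3) ℂ

/-- `𝒢_t(W) = 𝐁(Θ'W) e^{Q₊(Θ'W)} e^{Q^{uu}(W)} ∏_{w ∈ t}↑ ξ_w(W)` — the positive-time factor of the cone term `t`
for a rotated-frame torus function `𝐁` (the tree's `gObsT A mq t W` with `rotObs A` replaced by `𝐁`). -/
local notation "𝓖⟦" B ", " mq ", " t ", " W "⟧" =>
  (B (GaugeConfig.negReflect W) *
    grassmannExp (Literature.MathematicalPhysics.QuantumFieldTheory.posPart (GaugeConfig.negReflect W) mq) *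
    grassmannExp (uuPart W mq) * ordProd t (fun w => xiVar w W))

/-- `g_{t,J}(W) = [θ_{emb J}] ∫dθ_P 𝒢_t(W)` — the coefficient functions (the tree's `gCoef A mq t J W`). -/
local notation "𝓰⟦" B ", " mq ", " t ", " J ", " W "⟧" =>
  (Module.Basis.repr (grassmannBasis ℂ _) (berezinOn ℂ (posGens _ _) 𝓖⟦B, mq, t, W⟧) (Finset.image emb J))

section General

variable {Nf L : ℕ} [NeZero L]

/-! ### The frame: `R'` preserves the positive-time subalgebra; the OS integrand in the frame -/

/-- **The spin rotation `R'` maps the positive-time subalgebra into itself**: `R'` acts on a generator `ψ̄_{f,x,a,α}` /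
`ψ_{f,x,a,α}` by a spin sum at the same flavour, site and colour (`spinUnrot_qbar`, `spinUnrot_q`), so the image of a
generator of time `1 ≤ t ≤ L/2` is again a spectator of `N ∪ Z`. -/
theorem spinUnrot_mem_spectator {x : FermiAlg Nf L} (hx : x ∈ spectatorSubalgebra ℂ (negGens Nf L ∪ zeroGens Nf L)) :
    spinUnrot x ∈ spectatorSubalgebra ℂ (negGens Nf L ∪ zeroGens Nf L) := by
  -- adapted from QCDSiteRPFrame.spinUnrot_onTorus_mem
  set T := spectatorSubalgebra ℂ (negGens Nf L ∪ zeroGens Nf L) with hT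
  have hx' := hx
  rw [hT, spectatorSubalgebra_eq_adjoin] at hx'
  have hmem : spinUnrot x ∈ Subalgebra.map spinUnrot (Algebra.adjoin ℂ _) := Subalgebra.mem_map.2 ⟨x, hx', rfl⟩
  rw [AlgHom.map_adjoin] at hmem
  refine Algebra.adjoin_le ?_ hmem
  rintro _ ⟨_, ⟨w, hw, rfl⟩, rfl⟩
  have hw' : w ∉ negGens Nf L ∪ zeroGens Nf L := hw
  rw [Finset.mem_union, mem_negGens, mem_zeroGens] at hw'
  have ht : 1 ≤ genTimeT w ∧ genTimeT w ≤ L / 2 := by omega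
  rcases hi : ofLex w with i | i
  · have hi' : w = toLex (Sum.inl i) := by rw [← hi, toLex_ofLex]
    rw [hi'] at ht ⊢
    obtain ⟨⟨f, x, a, α⟩, rfl⟩ := quarkEquiv.surjective i
    change spinUnrot (qbar (f, (x, a, α))) ∈ T
    rw [spinUnrot_qbar]
    refine Subalgebra.sum_mem _ fun β _ => Subalgebra.smul_mem _ (gen_mem_spectator_of_time ?_) _
    simpa [genTimeT] using ht
  · have hi' : w = toLex (Sum.inr i) := by rw [← hi, toLex_ofLex]
    rw [hi'] at ht ⊢
    obtain ⟨⟨f, x, a, α⟩, rfl⟩ := quarkEquiv.surjective i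
    change spinUnrot (q (f, (x, a, α))) ∈ T
    rw [spinUnrot_q]
    refine Subalgebra.sum_mem _ fun β _ => Subalgebra.smul_mem _ (gen_mem_spectator_of_time ?_) _
    simpa [genTimeT] using ht

/-- **The OS pairing integrand of a torus function in the frame**:
`∫ X(V)·Θ_T(X(Θ'V))·e^{−ψ̄D^{AP}(V)ψ} = det R · ∫ R'X(V) · Θ'(R'X(Θ'V)) · e^{ψ̄M(V)ψ}`. -/
theorem fermiIntegral_osPairX_eq (X : GaugeConfig 4 L 𝔾 → FermiAlg Nf L) (V : GaugeConfig 4 L 𝔾) (mq : Fin Nf → ℝ) :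
    fermiIntegral (X V * torusTheta (X V.negReflect) * fermiBoltzmannAP V mq) =
      LinearMap.det (blockSubst ℂ (spinBlock (Nf := Nf) (L := L) ((2 : ℂ)⁻¹ • spinWᴴ)) (spinBlock ((2 : ℂ)⁻¹ • spinWᵀ))) *
        fermiIntegral (spinUnrot (X V) * fermiThetaRot (spinUnrot (X V.negReflect)) * grassmannExp (quadratic ℂ (rotDirac V mq))) := by
  -- adapted from QCDSiteReflectionPositivityProofs.fermiIntegral_osPair_eq
  rw [fermiIntegral_eq_det_mul_spinUnrot, map_mul spinUnrot, map_mul spinUnrot, spinUnrot_torusTheta, spinUnrot_fermiBoltzmannAP_eq]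

/-- **The pairing `⟨X · Θ_T X⟩_AP` is real** (every `β`, all masses): numerator and denominator of `qcdTorusExpectAP`
satisfy `N = c · conj N` with `c = thetaBerezinConst` (`Θ_T` is an antimultiplicative involution mapping the pairing
integrand at `U` to the one at `Θ'U`; the Boltzmann factor is reflection symmetric and central; `μ_W` is `Θ'`-invariant). -/
theorem qcdTorusExpectAP_pairX_im (Nf : ℕ) (β : ℝ) (S : ℕ) (mq : Fin Nf → ℝ) (X : GaugeConfig 4 (2 * S + 1) 𝔾 → FermiAlg Nf (2 * S + 1)) :
    (qcdTorusExpectAP β (2 * S + 1) mq (fun U => X U * torusTheta (X U.negReflect))).im = 0 := by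
  -- adapted from QCDTimeReflectionProofs.WilsonQCDSiteReflectionPositivityAP_im and torusTheta_pairingIntegrand
  have hL : Odd (2 * S + 1) := ⟨S, rfl⟩
  have hρ := continuous_fundamentalRep (Fin 3)
  unfold qcdTorusExpectAP
  refine div_im_eq_zero_of_eq_mul_conj (c := thetaBerezinConst Nf (2 * S + 1)) ?_ ?_
  · rw [← integral_conj, ← integral_const_mul, ← integral_comp_negReflect_eq (fundamentalRep (Fin 3)) hρ β]
    refine integral_congr_ae (Filter.Eventually.of_forall fun U => ?_)
    simp only
    rw [← fermiIntegral_torusTheta, torusTheta_mul, torusTheta_mul, torusTheta_fermiBoltzmannAP hL, torusTheta_torusTheta,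
      ← fermiBoltzmannAP_comm, negReflect_negReflect_config]
  · rw [← integral_conj, ← integral_const_mul, ← integral_comp_negReflect_eq (fundamentalRep (Fin 3)) hρ β]
    refine integral_congr_ae (Filter.Eventually.of_forall fun U => ?_)
    simp only
    rw [← fermiIntegral_torusTheta, torusTheta_fermiBoltzmannAP hL]

/-! ### The integrand under the Osterwalder–Seiler link split -/

/-- **The OS integrand under the link split** for a rotated-frame torus function `𝐁` depending on the positive
links only: for `V = translateLayer S Y U`, `z = splice_{layer}(U, Y)`,
`𝐁(V) Θ'(𝐁(Θ'V)) e^{ψ̄M(V)ψ} = G · Θ'H · ∏_{w ∈ layer}↑(1 + 2 ξ_w(Θ'U) Θ'ξ_w(z)) · e^{Q^{lu}(U)}` with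
`G = 𝐁(U) e^{Q₊(U)} e^{Q^{uu}(U)}`, `H = 𝐁(Θ'U) e^{Q₊(Θ'U)} e^{Q^{uu}(U)}`. -/
theorem osIntegrandX_translateLayer {S : ℕ} (hL : L = 2 * S + 1) (hS : 1 ≤ S) {B : GaugeConfig 4 L 𝔾 → FermiAlg Nf L}
    (hBc : ∀ U U' : GaugeConfig 4 L 𝔾, (∀ e ∈ posLinks S, U e = U' e) → B U = B U') (mq : Fin Nf → ℝ) (U Y : GaugeConfig 4 L 𝔾) :
    B (translateLayer S Y U) * fermiThetaRot (B (translateLayer S Y U).negReflect) *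
        grassmannExp (quadratic ℂ (rotDirac (translateLayer S Y U) mq)) =
      (B U * grassmannExp (posPart U mq) * grassmannExp (uuPart U mq)) *
        fermiThetaRot (B U.negReflect * grassmannExp (posPart U.negReflect mq) * grassmannExp (uuPart U mq)) *
        ordProd (layerGens S) (fun w => 1 + (2 : ℂ) • (xiVar w U.negReflect *
          fermiThetaRot (xiVar w (LatticeRP.splice (layerEdges S) (U, Y))))) * grassmannExp (luPart U mq) := by
  -- adapted from QCDSiteReflectionPositivityProofs.osIntegrand_translateLayer
  have hB₁ : B (translateLayer S Y U) = B U := hBc _ _ fun _ he => translateLayer_apply_of_not_layer Y U (not_layer_of_mem_posLinks he)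
  have hB₂ : B (translateLayer S Y U).negReflect = B U.negReflect := hBc _ _ fun _ he => negReflect_apply_eq_of_mem_posLinks hL hS
    (fun _ he' => translateLayer_apply_of_not_layer Y U (not_layer_of_mem_negSide he')) he
  have hPe := grassmannExp_even (even_of_eq_quadratic (rfl : posPart U mq = _)) (isNilpotent_of_eq_quadratic (rfl : posPart U mq = _))
  have hP'n := isNilpotent_of_eq_quadratic (rfl : posPart U.negReflect mq = _)
  have hle := grassmannExp_even (even_of_eq_quadratic (rfl : luPart U mq = _)) (isNilpotent_of_eq_quadratic (rfl : luPart U mq = _))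
  have hun := isNilpotent_of_eq_quadratic (rfl : uuPart U mq = _)
  have hue := grassmannExp_even (even_of_eq_quadratic (rfl : uuPart U mq = _)) hun
  have hNe : fermiThetaRot (grassmannExp (posPart U.negReflect mq)) ∈ evenOdd ℂ (ι := FermiIdx Nf L ⊕ₗ FermiIdx Nf L) 0 := by
    rw [Reflection.map_grassmannExp _ hP'n, ← negPart_eq_map hL mq U]
    exact grassmannExp_even (even_of_eq_quadratic rfl) (isNilpotent_of_eq_quadratic rfl)
  have hlle : fermiThetaRot (grassmannExp (uuPart U mq)) ∈ evenOdd ℂ (ι := FermiIdx Nf L ⊕ₗ FermiIdx Nf L) 0 := by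
    rw [Reflection.map_grassmannExp _ hun, ← llPart_eq_map_uuPart hL hS]
    exact grassmannExp_even (even_of_eq_quadratic rfl) (isNilpotent_of_eq_quadratic rfl)
  rw [hB₁, hB₂, grassmannExp_quadratic_rotDirac, posPart_translateLayer hL hS, negPart_eq_map hL,
    posPart_negReflect_translateLayer hL hS, ← Reflection.map_grassmannExp _ hP'n, zeroPart_translateLayer hL hS,
    grassmannExp_zeroPart U mq hL hS, grassmannExp_crossPart_translateLayer hL hS mq U Y,
    (fermiThetaRot (Nf := Nf) (L := L)).map_mul, (fermiThetaRot (Nf := Nf) (L := L)).map_mul]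
  exact central_rearrange _ _ _ _ _ _ _ _ (commute_of_mem_evenOdd_zero ℂ hPe) (commute_of_mem_evenOdd_zero ℂ hNe)
    (commute_of_mem_evenOdd_zero ℂ hle) (commute_of_mem_evenOdd_zero ℂ hue) (commute_of_mem_evenOdd_zero ℂ hlle)

/-! ### Supports -/

/-- **`𝒢_t(W)` is a spectator of `N ∪ L₀`** for `t ⊆ layerGens S`, when `𝐁` takes values in the positive-time subalgebra. -/
theorem gObsTX_mem {S : ℕ} (hL : L = 2 * S + 1) (hS : 1 ≤ S) {B : GaugeConfig 4 L 𝔾 → FermiAlg Nf L}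
    (hBm : ∀ U : GaugeConfig 4 L 𝔾, B U ∈ spectatorSubalgebra ℂ (negGens Nf L ∪ zeroGens Nf L))
    (mq : Fin Nf → ℝ) {t : Finset (FermiIdx Nf L ⊕ₗ FermiIdx Nf L)} (ht : t ⊆ layerGens S) (W : GaugeConfig 4 L 𝔾) :
    𝓖⟦B, mq, t, W⟧ ∈ spectatorSubalgebra ℂ (negGens Nf L ∪ lowerGens Nf L) := by
  -- adapted from QCDSiteReflectionPositivityProofs.gObsT_mem
  have hmono := spectatorSubalgebra_mono ℂ (negGens_union_lowerGens_subset (Nf := Nf) (L := L))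
  refine Subalgebra.mul_mem _ (Subalgebra.mul_mem _ (Subalgebra.mul_mem _ ?_ ?_) ?_) ?_
  · exact hmono (hBm _)
  · exact grassmannExp_mem (posPart_mem _ mq hL hS)
  · exact grassmannExp_mem (uuPart_mem _ mq)
  · rw [ordProd]
    refine Subalgebra.list_prod_mem _ fun x hx => ?_
    obtain ⟨w, hw, rfl⟩ := List.mem_map.1 hx
    exact hmono (xiVar_mem_spectator hS (by omega) (ht ((Finset.mem_sort _).1 hw)) W)

/-- **`∫dθ_P 𝒢_t(W) = Σ_J g_{t,J}(W) φ(ψ_J)`** (the partial integral is supported on the upper slice generators). -/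
theorem berezinOn_gObsTX_eq_sum {S : ℕ} (hL : L = 2 * S + 1) (hS : 1 ≤ S) {B : GaugeConfig 4 L 𝔾 → FermiAlg Nf L}
    (hBm : ∀ U : GaugeConfig 4 L 𝔾, B U ∈ spectatorSubalgebra ℂ (negGens Nf L ∪ zeroGens Nf L))
    (mq : Fin Nf → ℝ) {t : Finset (FermiIdx Nf L ⊕ₗ FermiIdx Nf L)} (ht : t ⊆ layerGens S) (W : GaugeConfig 4 L 𝔾) :
    berezinOn ℂ (posGens Nf L) 𝓖⟦B, mq, t, W⟧ =
      ∑ J : Finset (SliceIdx Nf L), 𝓰⟦B, mq, t, J, W⟧ • ExteriorAlgebra.map slicePhi (psiProd (SliceIdx Nf L) J) := by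
  -- adapted from QCDSiteReflectionPositivityProofs.berezinOn_gObsT_eq_sum
  have h := berezinOn_mem_spectatorSubalgebra ℂ (s := posGens Nf L) (gObsTX_mem hL hS hBm mq ht W)
  exact eq_sum_coord_smul_map_psiProd (spectatorSubalgebra_mono ℂ (Finset.subset_of_eq negGens_union_lowerGens_union_posGens.symm) h)

/-! ### The covariance identity -/

/-- **The fermionic covariance identity** for a rotated-frame torus function `𝐁` (positive links only, values in
the positive-time subalgebra): with `V = translateLayer S Y U`, `z = splice_{layer}(U,Y)`,
`∫ 𝐁(V)·Θ'(𝐁(Θ'V))·e^{ψ̄M(V)ψ} = c_N · C · (ε · det(−K(U))) · Σ_{t ⊆ layer} 2^{|t|} Σ_{I,J} g_{t,I}(Θ'U) conj g_{t,J}(z) Γ(K(U)⁻¹)_{IJ}`. -/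
theorem berezin_osIntegrandX_translateLayer {S : ℕ} (hL : L = 2 * S + 1) (hS : 1 ≤ S) {B : GaugeConfig 4 L 𝔾 → FermiAlg Nf L}
    (hBc : ∀ U U' : GaugeConfig 4 L 𝔾, (∀ e ∈ posLinks S, U e = U' e) → B U = B U')
    (hBm : ∀ U : GaugeConfig 4 L 𝔾, B U ∈ spectatorSubalgebra ℂ (negGens Nf L ∪ zeroGens Nf L))
    {mq : Fin Nf → ℝ} (hm : ∀ f, -1 < mq f) (U Y : GaugeConfig 4 L 𝔾) {cN : ℂ}
    (hcN : fermiThetaRot (grassmannBasis ℂ _ (posGens Nf L)) = cN • grassmannBasis ℂ _ (negGens Nf L)) :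
    fermiIntegral (B (translateLayer S Y U) * fermiThetaRot (B (translateLayer S Y U).negReflect) *
        grassmannExp (quadratic ℂ (rotDirac (translateLayer S Y U) mq))) =
      cN * topConst Nf L * ((-1 : ℂ) ^ (Fintype.card (SliceIdx Nf L) * (Fintype.card (SliceIdx Nf L) - 1) / 2) * (-sliceK U mq).det) *
        ∑ t ∈ (layerGens S).powerset, (2 : ℂ) ^ t.card * ∑ I : Finset (SliceIdx Nf L), ∑ J : Finset (SliceIdx Nf L),
          𝓰⟦B, mq, t, I, U.negReflect⟧ * conj 𝓰⟦B, mq, t, J, LatticeRP.splice (layerEdges S) (U, Y)⟧ * Gamma (sliceK U mq)⁻¹ I J := by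
  -- adapted from QCDSiteReflectionPositivityProofs.berezin_osIntegrand_translateLayer (with `gSide_eq`, `hSide_eq`)
  have hodd : Odd L := ⟨S, hL⟩
  have hL1 : 1 < L := by omega
  -- the `G`-side is `𝒢_∅(Θ'U)`, the `H`-side is `𝒢_∅(z)`, `z = splice_{layer}(U, Y)`
  have hGs : B U * grassmannExp (posPart U mq) * grassmannExp (uuPart U mq) =
      B U.negReflect.negReflect * grassmannExp (posPart U.negReflect.negReflect mq) * grassmannExp (uuPart U.negReflect mq) := by
    rw [negReflect_negReflect_config, uuPart_negReflect hL hS]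
  have hBz : B (GaugeConfig.negReflect (LatticeRP.splice (layerEdges S) (U, Y))) = B U.negReflect := hBc _ _ fun _ he =>
    negReflect_apply_eq_of_mem_posLinks hL hS (fun _ he' => splice_apply_of_not_layer U Y (not_layer_of_mem_negSide he')) he
  have hHs : B U.negReflect * grassmannExp (posPart U.negReflect mq) * grassmannExp (uuPart U mq) =
      B (GaugeConfig.negReflect (LatticeRP.splice (layerEdges S) (U, Y))) *
        grassmannExp (posPart (GaugeConfig.negReflect (LatticeRP.splice (layerEdges S) (U, Y))) mq) *
        grassmannExp (uuPart (LatticeRP.splice (layerEdges S) (U, Y)) mq) := by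
    rw [hBz, posPart_negReflect_splice hL hS, uuPart_splice hL hS]
  -- Step 1: the algebraic form of the integrand and the cone expansion
  rw [osIntegrandX_translateLayer hL hS hBc mq U Y, hGs, hHs, mul_map_mul_ordProd_cone fermiThetaRot (fun _ => (2 : ℂ))
    (fun w => xiVar_eq_ι w U.negReflect) (fun w => xiVar_eq_ι w (LatticeRP.splice (layerEdges S) (U, Y))), Finset.sum_mul, map_sum, Finset.mul_sum]
  refine Finset.sum_congr rfl fun t ht => ?_
  have ht' : t ⊆ layerGens S := Finset.mem_powerset.1 ht
  rw [Finset.prod_const, smul_mul_assoc, map_smul, smul_eq_mul]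
  -- Step 2: reduction to the slice
  have hG₁ : 𝓖⟦B, mq, t, U.negReflect⟧ ∈ spectatorSubalgebra ℂ (negGens Nf L) :=
    spectatorSubalgebra_mono ℂ negGens_subset_union (gObsTX_mem hL hS hBm mq ht' U.negReflect)
  have hG₂ : 𝓖⟦B, mq, t, LatticeRP.splice (layerEdges S) (U, Y)⟧ ∈ spectatorSubalgebra ℂ (negGens Nf L) :=
    spectatorSubalgebra_mono ℂ negGens_subset_union (gObsTX_mem hL hS hBm mq ht' _)
  rw [show (fermiIntegral : FermiAlg Nf L →ₗ[ℂ] ℂ) = berezin ℂ (FermiIdx Nf L ⊕ₗ FermiIdx Nf L) from rfl,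
    berezin_mul_map_mul_eq_top fermiThetaRot fermiThetaRot_gen reflGen_injective (image_reflGen_posGens hodd) disjoint_posGens_negGens
      (fun w hw => reflGen_not_mem_union hw) hcN hG₁ hG₂ (grassmannExp_mem (luPart_mem U mq))]
  -- Step 3: the slice Gaussian pairing (rewrite the two partial integrals on the left only: the coefficient functions on
  -- the right contain the same partial integrals)
  conv_lhs => rw [berezinOn_gObsTX_eq_sum hL hS hBm mq ht' U.negReflect,
    berezinOn_gObsTX_eq_sum hL hS hBm mq ht' (LatticeRP.splice (layerEdges S) (U, Y))]
  rw [grassmannExp_luPart_eq_map mq U hL1, ← topLam_apply, ← mul_assoc, map_pairing_gaussian_eq fermiThetaRot slicePhi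
    fermiThetaRot_map_slicePhi_psi topLam topLam_map_slicePhi (-sliceK U mq) (isUnit_det_neg_sliceK U mq hm), neg_inv_neg_sliceK U mq hm]
  ring

/-! ### Regularity and gauge dependence of the coefficient functions -/

/-- **`𝒢_t(W)` is coefficient-regular** when `𝐁` is. -/
theorem coeffRegular_gObsTX {B : GaugeConfig 4 L 𝔾 → FermiAlg Nf L} (hBr : CoeffRegular B) (mq : Fin Nf → ℝ)
    (t : Finset (FermiIdx Nf L ⊕ₗ FermiIdx Nf L)) : CoeffRegular (fun W : GaugeConfig 4 L 𝔾 => 𝓖⟦B, mq, t, W⟧) := by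
  -- adapted from QCDSiteReflectionPositivityProofs.coeffRegular_gObsT
  unfold Literature.MathematicalPhysics.QuantumFieldTheory.posPart ordProd
  exact (((hBr.comp measurable_negReflect).mul ((coeffRegular_grassmannExp_maskT mq (posR L)).comp measurable_negReflect)).mul
    (coeffRegular_grassmannExp_uuPart mq)).mul (CoeffRegular.list_prod _ fun w _ => coeffRegular_xiVar w)

/-- **`𝒢_t` depends on `negSide ∪ layer ∪ slice` only** when `𝐁` depends on the positive links only. -/
theorem gObsTX_congr {S : ℕ} (hL : L = 2 * S + 1) (hS : 1 ≤ S) {B : GaugeConfig 4 L 𝔾 → FermiAlg Nf L}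
    (hBc : ∀ U U' : GaugeConfig 4 L 𝔾, (∀ e ∈ posLinks S, U e = U' e) → B U = B U')
    (mq : Fin Nf → ℝ) {t : Finset (FermiIdx Nf L ⊕ₗ FermiIdx Nf L)} (ht : t ⊆ layerGens S) {W W' : GaugeConfig 4 L 𝔾}
    (h : ∀ e ∈ (negSideEdges S ∪ layerEdges S ∪ sliceZeroEdges : Finset (Edge 4 L)), W e = W' e) :
    𝓖⟦B, mq, t, W⟧ = 𝓖⟦B, mq, t, W'⟧ := by
  -- adapted from QCDSiteReflectionPositivityProofs.gObsT_congr
  have hN : ∀ e ∈ negSideEdges S, W e = W' e := fun e he => h e (by simp [he])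
  have hLy : ∀ e ∈ layerEdges S, W e = W' e := fun e he => h e (by simp [he])
  have hZ : ∀ e ∈ (sliceZeroEdges : Finset (Edge 4 L)), W e = W' e := fun e he => h e (by simp [he])
  rw [hBc _ _ (fun e he => negReflect_apply_eq_of_mem_posLinks hL hS hN he),
    posPart_congr hL hS mq (fun e he => negReflect_apply_eq_of_mem_posLinks hL hS hN he), uuPart_congr hL hS mq hZ]
  congr 1
  unfold ordProd
  congr 1
  exact List.map_congr_left fun w hw => xiVar_congr (ht ((Finset.mem_sort _).1 hw)) hLy

/-- **The pairing observable `V ↦ ∫ X(V) Θ_T(X(Θ'V)) e^{−ψ̄D^{AP}(V)ψ}` is measurable** for coefficient-regular `X`. -/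
theorem measurable_fermiIntegral_osPairX {X : GaugeConfig 4 L 𝔾 → FermiAlg Nf L} (hXr : CoeffRegular X) (mq : Fin Nf → ℝ) :
    Measurable fun V : GaugeConfig 4 L 𝔾 => fermiIntegral (X V * torusTheta (X V.negReflect) * fermiBoltzmannAP V mq) := by
  -- adapted from QCDSiteReflectionPositivityProofs.measurable_fermiIntegral_osPair
  have h : CoeffRegular fun V : GaugeConfig 4 L 𝔾 =>
      spinUnrot (X V) * fermiThetaRot (spinUnrot (X V.negReflect)) * grassmannExp (quadratic ℂ (rotDirac V mq)) := by
    refine ((hXr.algHom _).mul (((hXr.comp measurable_negReflect).algHom _).reflection _)).mul ?_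
    exact (coeffRegular_quadratic fun p q => continuous_rotDirac_apply mq p q).grassmannExp fun U => coord_empty_quadratic _
  simp only [fermiIntegral_osPairX_eq]
  exact (h.measurable_apply fermiIntegral).const_mul _

/-! ### Positivity of the numerator -/

/-- **Positivity of the OS pairing integral of a torus function, up to the constant**:
`0 ≤ c₀ · conj ∫ F_X dμ_W`, `F_X(V) = ∫dψ̄dψ X(V) Θ_T(X(Θ'V)) e^{−ψ̄D^{AP}(V)ψ}`, for every `X` depending on the
positive links only, with values in the positive-time subalgebra, coefficient-regular. -/
theorem posConst_mul_conj_integral_nonnegX {S : ℕ} (hL : L = 2 * S + 1) (hS : 1 ≤ S)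
    {X : GaugeConfig 4 L 𝔾 → FermiAlg Nf L}
    (hXc : ∀ U U' : GaugeConfig 4 L 𝔾, (∀ e ∈ posLinks S, U e = U' e) → X U = X U')
    (hXm : ∀ U : GaugeConfig 4 L 𝔾, X U ∈ spectatorSubalgebra ℂ (negGens Nf L ∪ zeroGens Nf L))
    (hXr : CoeffRegular X) {mq : Fin Nf → ℝ} (hm : ∀ f, -1 < mq f) {β : ℝ} (hβ : 0 ≤ β) {cN : ℂ}
    (hcN : fermiThetaRot (grassmannBasis ℂ _ (posGens Nf L)) = cN • grassmannBasis ℂ _ (negGens Nf L)) :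
    0 ≤ posConst (Nf := Nf) (L := L) cN *
      conj (∫ V, fermiIntegral (X V * torusTheta (X V.negReflect) * fermiBoltzmannAP V mq)
        ∂(wilsonMeasure (d := 4) (L := L) (fundamentalRep (Fin 3)) β)) := by
  -- adapted from QCDSiteReflectionPositivityProofs.posConst_mul_conj_integral_nonneg
  -- the rotated torus function and its three properties
  set B : GaugeConfig 4 L 𝔾 → FermiAlg Nf L := fun V => spinUnrot (X V)
  have hB' : ∀ V, spinUnrot (X V) = B V := fun V => rfl
  have hBc : ∀ U U' : GaugeConfig 4 L 𝔾, (∀ e ∈ posLinks S, U e = U' e) → B U = B U' := fun U U' h => by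
    rw [← hB', ← hB', hXc U U' h]
  have hBm : ∀ U : GaugeConfig 4 L 𝔾, B U ∈ spectatorSubalgebra ℂ (negGens Nf L ∪ zeroGens Nf L) := fun U =>
    spinUnrot_mem_spectator (hXm U)
  have hBr : CoeffRegular B := hXr.algHom _
  set c₀ := posConst (Nf := Nf) (L := L) cN with hc₀
  set F : GaugeConfig 4 L 𝔾 → ℂ := fun V =>
    fermiIntegral (X V * torusTheta (X V.negReflect) * fermiBoltzmannAP V mq) with hF
  have hFm : Measurable F := measurable_fermiIntegral_osPairX hXr mq
  -- regularity, bounds and dependence of the coefficient functions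
  have hgm : ∀ a : MechIdx Nf L S, Measurable fun W : GaugeConfig 4 L 𝔾 => 𝓰⟦B, mq, a.1.1, a.2, W⟧ := fun a =>
    (((coeffRegular_gObsTX hBr mq a.1.1).linearMap (berezinOn ℂ (posGens Nf L))) (a.2.image emb)).1
  have hgb : ∀ a : MechIdx Nf L S, ∃ C : ℝ, ∀ W : GaugeConfig 4 L 𝔾, ‖𝓰⟦B, mq, a.1.1, a.2, W⟧‖ ≤ C := fun a =>
    (((coeffRegular_gObsTX hBr mq a.1.1).linearMap (berezinOn ℂ (posGens Nf L))) (a.2.image emb)).2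
  have hgdep : ∀ a : MechIdx Nf L S, DependsOn (fun W : GaugeConfig 4 L 𝔾 => 𝓰⟦B, mq, a.1.1, a.2, W⟧)
      (↑(negSideEdges S ∪ layerEdges S ∪ sliceZeroEdges : Finset (Edge 4 L)) : Set (Edge 4 L)) := by
    intro a W W' h
    beta_reduce
    rw [gObsTX_congr hL hS hBc mq (Finset.mem_powerset.1 a.1.2) (fun e he => h e (Finset.mem_coe.2 he))]
  -- uniform bounds
  choose Cg hCg using hgb
  choose Cp hCp using fun ab : MechIdx Nf L S × MechIdx Nf L S => exists_bound_mechKernel mq hm c₀ ab.1 ab.2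
  set Kg : ℝ := ∑ a, |Cg a| + ∑ ab, |Cp ab| with hKg
  have hKg1 : ∀ a, Cg a ≤ Kg := fun a =>
    ((le_abs_self _).trans (Finset.single_le_sum (f := fun a => |Cg a|) (fun _ _ => abs_nonneg _)
      (Finset.mem_univ a))).trans (le_add_of_nonneg_right (Finset.sum_nonneg fun _ _ => abs_nonneg _))
  have hKg2 : ∀ ab, Cp ab ≤ Kg := fun ab =>
    ((le_abs_self _).trans (Finset.single_le_sum (f := fun ab => |Cp ab|) (fun _ _ => abs_nonneg _)
      (Finset.mem_univ ab))).trans (le_add_of_nonneg_left (Finset.sum_nonneg fun _ _ => abs_nonneg _))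
  -- `conj c₀` in pieces
  have hcc : conj c₀ = conj (LinearMap.det (blockSubst ℂ (spinBlock (Nf := Nf) (L := L) ((2 : ℂ)⁻¹ • spinWᴴ))
      (spinBlock ((2 : ℂ)⁻¹ • spinWᵀ)))) * conj cN * conj (topConst Nf L) *
      (-1 : ℂ) ^ (Fintype.card (SliceIdx Nf L) * (Fintype.card (SliceIdx Nf L) - 1) / 2) := by
    simp only [hc₀, posConst, map_mul, map_pow, map_neg, map_one]
  -- the covariance identity
  have hcov : ∀ U Y : GaugeConfig 4 L 𝔾, c₀ * conj (F (translateLayer S Y U)) =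
      ∑ a : MechIdx Nf L S, ∑ b : MechIdx Nf L S,
        𝓰⟦B, mq, a.1.1, a.2, LatticeRP.splice (layerEdges S) (U, Y)⟧ *
          conj 𝓰⟦B, mq, b.1.1, b.2, U.negReflect⟧ * mechKernel mq c₀ a b U := by
    intro U Y
    simp only [hF]
    rw [fermiIntegral_osPairX_eq, hB', hB', berezin_osIntegrandX_translateLayer hL hS hBc hBm hm U Y hcN]
    -- right-hand side: collapse the block-diagonal kernel to a sum over `t ⊆ layer`
    have hRHS : (∑ a : MechIdx Nf L S, ∑ b : MechIdx Nf L S,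
          𝓰⟦B, mq, a.1.1, a.2, LatticeRP.splice (layerEdges S) (U, Y)⟧ *
            conj 𝓰⟦B, mq, b.1.1, b.2, U.negReflect⟧ * mechKernel mq c₀ a b U) =
        ∑ t ∈ (layerGens S).powerset, ∑ J : Finset (SliceIdx Nf L), ∑ I : Finset (SliceIdx Nf L),
          𝓰⟦B, mq, t, J, LatticeRP.splice (layerEdges S) (U, Y)⟧ * conj 𝓰⟦B, mq, t, I, U.negReflect⟧ *
            (c₀ * conj c₀ * (2 : ℂ) ^ t.card * conj ((-sliceK U mq).det) * conj (Gamma (sliceK U mq)⁻¹ I J)) := by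
      rw [Fintype.sum_prod_type, ← Finset.sum_coe_sort (layerGens S).powerset]
      refine Finset.sum_congr rfl fun t _ => Finset.sum_congr rfl fun J _ => ?_
      rw [Fintype.sum_prod_type, Finset.sum_comm]
      refine Finset.sum_congr rfl fun I _ => ?_
      simp only [mechKernel, mul_ite, mul_zero]
      rw [Finset.sum_ite_eq, if_pos (Finset.mem_univ _)]
    rw [hRHS]
    -- left-hand side: distribute `conj` and the constants
    simp only [map_mul, map_sum, map_pow, map_neg, map_one, map_ofNat, Complex.conj_conj, Finset.mul_sum]
    refine Finset.sum_congr rfl fun t _ => ?_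
    rw [Finset.sum_comm]
    refine Finset.sum_congr rfl fun J _ => Finset.sum_congr rfl fun I _ => ?_
    rw [hcc]
    ring
  have key := wilsonExpectation_nonneg_of_negCovariantKernel (d := 4) (G := 𝔾) (fundamentalRep (Fin 3)) hL hS
    (continuous_fundamentalRep (Fin 3)) hβ (𝓘 := MechIdx Nf L S)
    (g := fun a W => 𝓰⟦B, mq, a.1.1, a.2, W⟧) (Pk := mechKernel mq c₀)
    hgm (fun a b => measurable_mechKernel mq hm c₀ a b) (Kg := Kg)
    (fun a U => (hCg a U).trans (hKg1 a)) (fun a b U => (hCp (a, b) U).trans (hKg2 (a, b)))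
    hgdep (fun a b => dependsOn_mechKernel mq c₀ a b) (fun V x => mechKernel_psd mq hm c₀ V x)
    (Φ := fun V => c₀ * conj (F V)) ((Complex.continuous_conj.measurable.comp hFm).const_mul _) hcov
  change 0 ≤ ∫ V, c₀ * conj (F V) ∂(wilsonMeasure (d := 4) (L := L) (fundamentalRep (Fin 3)) β) at key
  rwa [integral_const_mul, integral_conj] at key

end General

/-! ### The registered stub -/

/-- **W2b: abstract site-reflection positivity of the thermal functional.**  For `β ≥ 0`, `m_f > −1`, `S ≥ 1` and
every torus function `X` on the odd torus `L = 2S+1` that depends on the positive links only, takes values in the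
positive-time subalgebra (a spectator of `negGens ∪ zeroGens`) and is coefficient-regular, the thermal pairing
`⟨X · Θ_T X⟩_AP = qcdTorusExpectAP β L mq (U ↦ X U * torusTheta (X (Θ'U)))` is real and non-negative. -/
theorem stub_abstractThermalRP : ∀ {Nf : ℕ} (S : ℕ), 1 ≤ S → ∀ (β : ℝ), 0 ≤ β →
    ∀ (mq : Fin Nf → ℝ), (∀ f, -1 < mq f) →
    ∀ (X : GaugeConfig 4 (2 * S + 1) 𝔾 → FermiAlg Nf (2 * S + 1)),
      (∀ U U' : GaugeConfig 4 (2 * S + 1) 𝔾, (∀ e ∈ posLinks S, U e = U' e) → X U = X U') →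
      (∀ U : GaugeConfig 4 (2 * S + 1) 𝔾,
        X U ∈ spectatorSubalgebra ℂ (negGens Nf (2 * S + 1) ∪ zeroGens Nf (2 * S + 1))) →
      CoeffRegular X →
      0 ≤ (qcdTorusExpectAP β (2 * S + 1) mq (fun U => X U * torusTheta (X U.negReflect))).re ∧
        (qcdTorusExpectAP β (2 * S + 1) mq (fun U => X U * torusTheta (X U.negReflect))).im = 0 := by
  -- adapted from QCDSiteReflectionPositivityProofs.WilsonQCDSiteReflectionPositivityAP_holds
  intro Nf S hS β hβ mq hm X hXc hXm hXr
  refine ⟨?_, qcdTorusExpectAP_pairX_im Nf β S mq X⟩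
  obtain ⟨cN, hcNne, hcN⟩ := exists_fermiThetaRot_basis_posGens_ne (Nf := Nf) (L := 2 * S + 1) ⟨S, rfl⟩
  have hN := posConst_mul_conj_integral_nonnegX (L := 2 * S + 1) rfl hS hXc hXm hXr hm hβ hcN
  have hD := posConst_mul_conj_integral_nonneg (L := 2 * S + 1) (QCDLatticeObservable.one Nf 0) mq rfl hS (by omega)
    (one_isPositiveTime Nf) (one_linksEndBy Nf S) hm hβ hcN
  simp only [one_osPair, one_mul] at hD
  unfold qcdTorusExpectAP
  exact re_div_nonneg_of_mul_conj_nonneg (posConst_ne_zero hcNne) hN hD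

end Summit.QuantumFields.QCD.Cruxes.StableActionBridge.Sketch

end
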